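import Literature.Probability.NegativeDependence.SymmetricExclusionEquilibrium
import Literature.Probability.NegativeDependence.CNAPlusCounterexamples
import Literature.Probability.NegativeDependence.ExchangeableRayleigh
import HarnessLib

/-!
# The symmetric exclusion process preserves none of NLC, h-NLC, Rayleigh, CNA, CNA+
# (Borcea–Brändén–Liggett §3.5 and Remark 5.2; Remark 5.3)

J. Borcea, P. Brändén, T. M. Liggett, *Negative dependence and the geometry of polynomials*, J. Amer. Math. Soc.
22 (2009) 521–567 (arXiv:0707.2340, held `paper:arxiv-0707.2340`; numbering of the arXiv version). Verbatim:

> (§3.5) Since the limiting distribution of the evolution as `t → ∞` is the symmetrization of the initial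
> distribution defined in [§2.1 (v)], any such property would have to be preserved by this symmetrization
> procedure. […] In [L2] it was proved that NA is not preserved by the symmetric exclusion process. The examples
> that we construct in §7 further show that in fact none of the properties NLC, h-NLC, Rayleigh/h-NLC+, CNA, CNA+
> defined in §2.1 is preserved by such evolutions. This is a consequence of the following criterion established
> by Pemantle in [P] (see also [W]) for the ultra log-concavity of rank sequences of symmetric polynomials in
> `𝔓_n`: **Theorem 3.7 ([P]).** […] The following are equivalent: (i) `f` […] has an ULC rank sequence;
> (ii) `f` has either (and then all) of the following five properties: NLC, h-NLC, Rayleigh/h-NLC+, CNA, CNA+.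
>
> (§5) **Remark 5.2.** If `q_{i,j} > 0` for all `i, j`, then as we noted in §3.5 the limiting distribution of
> `η_t` as `t → ∞` is the symmetrization of the initial distribution. In §7 we construct examples of measures in
> `𝔓_n`, `n ≥ 20`, that are CNA+ but do not have ULC rank sequences. By Theorem 3.7 in §3.5, these
> counterexamples to Conjectures 2.3–2.5 show that none of the properties NLC, h-NLC, Rayleigh/h-NLC+, CNA, CNA+
> is preserved by the symmetrization procedure [§2.1 (v)], and by [L2], the same can be said about the NA property.
> Therefore, the analog of Proposition 5.1 fails for all the aforementioned properties.
>
> **Remark 5.3.** The analog of Theorem 5.2 for asymmetric exclusion processes is false. A simple example is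
> obtained by taking `S = {1,2}` in which only transitions from state 1 to state 2 are allowed. If the initial
> distribution gives probability `¼` to each of the configurations in `{0,1}^S`, then the limiting distribution
> as `t → ∞` is given by `μ({11}) = μ({00}) = ¼`, `μ({10}) = 0`, and `μ({01}) = ½`. This measure is not NA.

## What is here

Everything is assembled from the tree: the CNA+ probability measure `μ` on `2^[20]` with non-ULC rank sequence
of §7 (`BorceaBrandenLiggett_conjecture_2_5_fails`, `CNAPlusCounterexamples`), Pemantle's criterion in the form
"an exchangeable nonnegative NLC weight has a `PF₂` profile, hence an ULC rank sequence"
(`IsExchangeable.isNLC_iff`, `isUltraLogConcave_rankSeq_card`, `ExchangeableRayleigh`), the symmetrization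
`μ_s` with `(μ_s)` exchangeable and `rankSeq μ_s = rankSeq μ`, and the convergence `μ T(t) → μ_s` of the
symmetric exclusion process with all rates positive (`tendsto_sepLaw_atTop`, `SymmetricExclusionEquilibrium`).

* §1 `isUltraLogConcave_rankSeq_of_isNLC_symmW`: if `μ ≥ 0` and `μ_s` is NLC then the rank sequence of `μ` is
  ULC (Thm. 3.7 (ii) ⟹ (i) applied to `μ_s`); hence **`BorceaBrandenLiggett_remark_5_2_symmetrization`**: the
  symmetrization of the §7 measure is not NLC (so not h-NLC, Rayleigh, CNA, CNA+ either) although the measure is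
  CNA+ — "none of the properties … is preserved by the symmetrization procedure".
* §2 `isClosed_setOf_isNLC` (NLC is a closed condition) and **`BorceaBrandenLiggett_remark_5_2`**: for the
  symmetric exclusion process on `{0,1}^[20]` with all rates `1` started from the §7 measure there is a time
  `t ≥ 0` at which the law `μ T(t)` is not NLC, not h-NLC, not Rayleigh, not CNA and not CNA+ — "the analog of
  Proposition 5.1 fails for all the aforementioned properties". (The NA statement of [L2] is not formalized.)
* §3 **`BorceaBrandenLiggett_remark_5_3`**: the measure `μ({11}) = μ({00}) = ¼, μ({10}) = 0, μ({01}) = ½` on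
  `{0,1}^{{1,2}}` is not NA (indeed `X_1, X_2` are positively correlated). -- TODO(general form): the asymmetric
  exclusion dynamics producing it as a `t → ∞` limit is not formalized; only the printed claim "This measure is
  not NA" is.

No `sorry`, no named fact, no new definition besides the explicit measure of Remark 5.3.

## References

* [BorceaBrandenLiggett2007] J. Borcea, P. Brändén, T. M. Liggett, Negative dependence and the geometry of
  polynomials, J. Amer. Math. Soc. 22 (2009); arXiv:0707.2340 — §3.5 (Problem 3.5, Thm. 3.7), §5 Remarks 5.2,
  5.3, §7 Counterexample 1.
* [Pemantle2000] R. Pemantle, Towards a theory of negative dependence, J. Math. Phys. 41 (2000) — Thm. 2.7.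
-/

noncomputable section

open Finset Filter Topology
open Literature.Combinatorics.Sahi2008
open Literature.Probability.Distributions
open Literature.Combinatorics.LorentzianPolynomials (IsUltraLogConcave)

namespace Literature.Probability.NegativeDependence

variable {σ : Type*} [Fintype σ] [DecidableEq σ]

/-! ## §1 Symmetrization does not preserve NLC, …, CNA+ -/

section Symmetrization

/-- **Thm. 3.7 (ii) ⟹ (i) at the symmetrization**: if `μ ≥ 0` and `μ_s` is NLC then the rank sequence of `μ`
(= that of `μ_s`) is ULC — `μ_s` is exchangeable, so NLC forces a `PF₂` profile `μ_s(S) = q(|S|)` (Pemantle),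
whose rank sequence `binom(n,k) q(k)` is ULC. [cite: BorceaBrandenLiggett2007, §3.5 Thm. 3.7, §5 Remark 5.2]
[cite: Pemantle2000, §2.4 Thm. 2.7] -/
theorem isUltraLogConcave_rankSeq_of_isNLC_symmW {μ : Finset σ → ℝ} (h0 : ∀ S, 0 ≤ μ S)
    (h : IsNLC (symmW μ)) : IsUltraLogConcave (Fintype.card σ) (rankSeq μ) := by
  obtain ⟨q, hq, hμ⟩ := ((isExchangeable_symmW μ).isNLC_iff (symmW_nonneg h0)).1 h
  have hs : symmW μ = fun S => q S.card := funext hμ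
  have key := isUltraLogConcave_rankSeq_card (σ := σ) hq
  rw [← hs] at key
  intro k hk hkn
  have := key k hk hkn
  simpa only [rankSeq_symmW] using this

/-- Consequently, if the rank sequence of `μ ≥ 0` is not ULC then `μ_s` has none of the five properties NLC, h-NLC,
Rayleigh, CNA, CNA+. [cite: BorceaBrandenLiggett2007, §3.5 Thm. 3.7, §5 Remark 5.2] -/
theorem not_isNLC_symmW_of_not_isUltraLogConcave {μ : Finset σ → ℝ} (h0 : ∀ S, 0 ≤ μ S)
    (h : ¬ IsUltraLogConcave (Fintype.card σ) (rankSeq μ)) :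
    ¬ IsNLC (symmW μ) ∧ ¬ IsHNLC (symmW μ) ∧ ¬ IsRayleigh (symmW μ) ∧ ¬ IsCNA (symmW μ) ∧ ¬ IsCNAPlus (symmW μ) := by
  have hN : ¬ IsNLC (symmW μ) := fun hN => h (isUltraLogConcave_rankSeq_of_isNLC_symmW h0 hN)
  have h0s : ∀ S, 0 ≤ symmW μ S := symmW_nonneg h0
  exact ⟨hN, fun h' => hN h'.isNLC, fun h' => hN (h'.isNLC h0s), fun h' => hN (h'.isNLC h0s),
    fun h' => hN (h'.isCNA.isNLC h0s)⟩

/-- **Remark 5.2 / §3.5, symmetrization form: "none of the properties NLC, h-NLC, Rayleigh/h-NLC+, CNA, CNA+ is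
preserved by the symmetrization procedure"** — witnessed by the CNA+ probability measure on `2^[20]` of §7
(Counterexample 1), whose rank sequence is not ULC. [cite: BorceaBrandenLiggett2007, §5 Remark 5.2, §3.5,
§7 Counterexample 1] -/
theorem BorceaBrandenLiggett_remark_5_2_symmetrization :
    ∃ μ : Finset (Option (Fin 19)) → ℝ,
      (∀ U, 0 ≤ μ U) ∧ mass μ = 1 ∧ IsCNAPlus μ ∧
        ¬ IsNLC (symmW μ) ∧ ¬ IsHNLC (symmW μ) ∧ ¬ IsRayleigh (symmW μ) ∧ ¬ IsCNA (symmW μ) ∧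
          ¬ IsCNAPlus (symmW μ) := by
  obtain ⟨μ, h0, hmass, hcna, hulc⟩ := BorceaBrandenLiggett_conjecture_2_5_fails
  have hcard : Fintype.card (Option (Fin 19)) = 20 := by simp
  rw [← hcard] at hulc
  exact ⟨μ, h0, hmass, hcna, not_isNLC_symmW_of_not_isUltraLogConcave h0 hulc⟩

end Symmetrization

/-! ## §2 The symmetric exclusion process preserves none of NLC, …, CNA+ -/

section Exclusion

omit [Fintype σ] in
/-- NLC (`μ(S ∪ T) μ(S ∩ T) ≤ μ(S) μ(T)` for all `S, T`) is a closed condition on weights.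
[cite: BorceaBrandenLiggett2007, §2.1 Def. 2.2 (NLC), §3.5] -/
theorem isClosed_setOf_isNLC : IsClosed {ν : Finset σ → ℝ | IsNLC ν} := by
  simp only [IsNLC, Set.setOf_forall]
  refine isClosed_iInter fun S => isClosed_iInter fun T => ?_
  exact isClosed_le (by fun_prop) (by fun_prop)

/-- If the law of a symmetric exclusion process with all rates positive were NLC at all times `t ≥ 0`, its limit
`μ_s` would be NLC. [cite: BorceaBrandenLiggett2007, §3.5 ("any such property would have to be preserved by this
symmetrization procedure"), §5 Remark 5.2] -/
theorem isNLC_symmW_of_forall_isNLC_sepLaw {q : σ → σ → ℝ} (hq : ∀ a b, 0 ≤ q a b)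
    (hq' : ∀ a b, a ≠ b → 0 < q a b) {μ : Finset σ → ℝ} (h : ∀ t : ℝ, 0 ≤ t → IsNLC (sepLaw q t μ)) :
    IsNLC (symmW μ) :=
  isClosed_setOf_isNLC.mem_of_tendsto (tendsto_sepLaw_atTop hq hq' μ)
    (by filter_upwards [eventually_ge_atTop 0] with t ht using h t ht)

/-- **Borcea–Brändén–Liggett, Remark 5.2: "the analog of Proposition 5.1 fails for all the aforementioned
properties"** (NLC, h-NLC, Rayleigh/h-NLC+, CNA, CNA+): for the symmetric exclusion process on `{0,1}^[20]` with
all rates `q_{i,j} = 1`, started from the CNA+ probability measure of §7 (Counterexample 1), there is a time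
`t ≥ 0` at which the distribution of `η_t` is not NLC, not h-NLC, not Rayleigh, not CNA and not CNA+.
[cite: BorceaBrandenLiggett2007, §5 Remark 5.2, §3.5, §7 Counterexample 1] -/
theorem BorceaBrandenLiggett_remark_5_2 :
    ∃ (μ : Finset (Option (Fin 19)) → ℝ) (t : ℝ),
      (∀ U, 0 ≤ μ U) ∧ mass μ = 1 ∧ IsCNAPlus μ ∧ 0 ≤ t ∧
        ¬ IsNLC (sepLaw (fun _ _ => (1 : ℝ)) t μ) ∧ ¬ IsHNLC (sepLaw (fun _ _ => (1 : ℝ)) t μ) ∧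
          ¬ IsRayleigh (sepLaw (fun _ _ => (1 : ℝ)) t μ) ∧ ¬ IsCNA (sepLaw (fun _ _ => (1 : ℝ)) t μ) ∧
            ¬ IsCNAPlus (sepLaw (fun _ _ => (1 : ℝ)) t μ) := by
  obtain ⟨μ, h0, hmass, hcna, hN, -⟩ := BorceaBrandenLiggett_remark_5_2_symmetrization
  have hq : ∀ a b : Option (Fin 19), 0 ≤ (fun _ _ => (1 : ℝ)) a b := fun _ _ => zero_le_one
  have hq' : ∀ a b : Option (Fin 19), a ≠ b → 0 < (fun _ _ => (1 : ℝ)) a b := fun _ _ _ => one_pos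
  -- some time `t ≥ 0` at which the law is not NLC
  obtain ⟨t, ht, hNt⟩ : ∃ t : ℝ, 0 ≤ t ∧ ¬ IsNLC (sepLaw (fun _ _ => (1 : ℝ)) t μ) := by
    by_contra hall
    exact hN (isNLC_symmW_of_forall_isNLC_sepLaw hq hq' fun t ht => not_not.1 fun hc => hall ⟨t, ht, hc⟩)
  have h0t : ∀ S, 0 ≤ sepLaw (fun _ _ => (1 : ℝ)) t μ S := sepLaw_nonneg hq ht h0
  exact ⟨μ, t, h0, hmass, hcna, ht, hNt, fun h' => hNt h'.isNLC, fun h' => hNt (h'.isNLC h0t),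
    fun h' => hNt (h'.isNLC h0t), fun h' => hNt (h'.isCNA.isNLC h0t)⟩

end Exclusion

/-! ## §3 Remark 5.3: the asymmetric two-site example is not NA -/

section Remark53

/-- The measure of Remark 5.3 on `{0,1}^{{1,2}}` (sites `0, 1` of `Fin 2`): `μ({11}) = μ({00}) = ¼`,
`μ({10}) = 0`, `μ({01}) = ½` — the `t → ∞` law of the totally asymmetric exclusion process on two sites (only
jumps from site 1 to site 2) started from the uniform distribution. [cite: BorceaBrandenLiggett2007, §5 Remark
5.3] -/
def remark53Weight : Finset (Fin 2) → ℝ := fun S =>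
  if S = {0, 1} then 1 / 4 else if S = ∅ then 1 / 4 else if S = {1} then 1 / 2 else 0

/-- Unfolding `remark53Weight`. [cite: BorceaBrandenLiggett2007, §5 Remark 5.3] -/
theorem remark53Weight_apply (S : Finset (Fin 2)) :
    remark53Weight S = if S = {0, 1} then 1 / 4 else if S = ∅ then 1 / 4 else if S = {1} then 1 / 2 else 0 :=
  rfl

/-- Sums over `2^{Fin 2}`. [cite: BorceaBrandenLiggett2007, §5 Remark 5.3 (the four configurations of
`{0,1}^S`, `S = {1,2}`)] -/
theorem sum_finset_fin_two (f : Finset (Fin 2) → ℝ) :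
    ∑ S : Finset (Fin 2), f S = f ∅ + f {0} + f {1} + f {0, 1} := by
  have huniv : (univ : Finset (Finset (Fin 2))) = {∅, {0}, {1}, {0, 1}} := by decide
  rw [huniv, sum_insert (by decide), sum_insert (by decide), sum_insert (by decide), sum_singleton]
  ring

/-- The measure of Remark 5.3 is a probability measure. [cite: BorceaBrandenLiggett2007, §5 Remark 5.3] -/
theorem remark53Weight_nonneg_and_mass : (∀ S, 0 ≤ remark53Weight S) ∧ mass remark53Weight = 1 := by
  refine ⟨fun S => ?_, ?_⟩
  · rw [remark53Weight_apply]
    split_ifs <;> norm_num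
  · rw [mass_def, sum_finset_fin_two]
    simp only [remark53Weight_apply]
    norm_num [show ({0} : Finset (Fin 2)) ≠ {0, 1} by decide, show ({1} : Finset (Fin 2)) ≠ {0, 1} by decide,
      show (∅ : Finset (Fin 2)) ≠ {0, 1} by decide, show ({0} : Finset (Fin 2)) ≠ ∅ by decide,
      show ({1} : Finset (Fin 2)) ≠ ∅ by decide, show ({0} : Finset (Fin 2)) ≠ {1} by decide,
      show ({0, 1} : Finset (Fin 2)) ≠ ∅ by decide]

/-- **Borcea–Brändén–Liggett, Remark 5.3: "This measure is not NA"** — the occupation variables of the two sites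
are even positively correlated: `μ(X_1 X_2) μ(Ω) = ¼ > 3/16 = μ(X_1) μ(X_2)`.
[cite: BorceaBrandenLiggett2007, §5 Remark 5.3] -/
theorem BorceaBrandenLiggett_remark_5_3 : ¬ IsNegAssoc remark53Weight := by
  intro h
  have hF : Monotone (fun S : Finset (Fin 2) => if (0 : Fin 2) ∈ S then (1 : ℝ) else 0) := by
    intro S T hST; dsimp only
    by_cases h0 : (0 : Fin 2) ∈ S
    · rw [if_pos h0, if_pos (hST h0)]
    · rw [if_neg h0]; split_ifs <;> norm_num
  have hG : Monotone (fun S : Finset (Fin 2) => if (1 : Fin 2) ∈ S then (1 : ℝ) else 0) := by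
    intro S T hST; dsimp only
    by_cases h1 : (1 : Fin 2) ∈ S
    · rw [if_pos h1, if_pos (hST h1)]
    · rw [if_neg h1]; split_ifs <;> norm_num
  have hFE : DeterminedBy (fun S : Finset (Fin 2) => if (0 : Fin 2) ∈ S then (1 : ℝ) else 0) {0} := by
    intro S T hST
    have : (0 : Fin 2) ∈ S ↔ (0 : Fin 2) ∈ T := by
      constructor
      · intro h0; have := mem_inter.2 ⟨h0, mem_singleton_self (0 : Fin 2)⟩; rw [hST] at this
        exact (mem_inter.1 this).1
      · intro h0; have := mem_inter.2 ⟨h0, mem_singleton_self (0 : Fin 2)⟩; rw [← hST] at this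
        exact (mem_inter.1 this).1
    simp only [this]
  have hGE : DeterminedBy (fun S : Finset (Fin 2) => if (1 : Fin 2) ∈ S then (1 : ℝ) else 0) {1} := by
    intro S T hST
    have : (1 : Fin 2) ∈ S ↔ (1 : Fin 2) ∈ T := by
      constructor
      · intro h1; have := mem_inter.2 ⟨h1, mem_singleton_self (1 : Fin 2)⟩; rw [hST] at this
        exact (mem_inter.1 this).1
      · intro h1; have := mem_inter.2 ⟨h1, mem_singleton_self (1 : Fin 2)⟩; rw [← hST] at this
        exact (mem_inter.1 this).1
    simp only [this]
  have hdisj : Disjoint ({0} : Finset (Fin 2)) {1} := by decide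
  have key := h hF hG hFE hGE hdisj
  rw [remark53Weight_nonneg_and_mass.2, mul_one, ex_def, ex_def, ex_def, sum_finset_fin_two, sum_finset_fin_two,
    sum_finset_fin_two] at key
  simp only [Pi.mul_apply, remark53Weight_apply] at key
  norm_num [show ({0} : Finset (Fin 2)) ≠ {0, 1} by decide, show ({1} : Finset (Fin 2)) ≠ {0, 1} by decide,
      show (∅ : Finset (Fin 2)) ≠ {0, 1} by decide, show ({0} : Finset (Fin 2)) ≠ ∅ by decide,
      show ({1} : Finset (Fin 2)) ≠ ∅ by decide, show ({0} : Finset (Fin 2)) ≠ {1} by decide,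
      show ({0, 1} : Finset (Fin 2)) ≠ ∅ by decide] at key

end Remark53

end Literature.Probability.NegativeDependence
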